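import Literature.NumberTheory.EllipticCurves.CMTransformationPolynomials
import Literature.NumberTheory.EllipticCurves.SingularModuliConjugate
import Literature.NumberTheory.EllipticCurves.UniformizationProofs
import Literature.NumberTheory.EllipticCurves.CMLatticeHomothety
import Literature.FieldTheory.AlgClosed.AutomorphismExtension
import HarnessLib

/-!
# Singular moduli are permuted by `Aut(ℂ)`: Cox's Theorem 10.23
# (`j(τ_Q)` is an algebraic number of degree `≤ h(D)`, its conjugates are the `j(τ_{Q'})`, `disc Q' = disc Q`)

Topic `NumberTheory/EllipticCurves` (complex multiplication); a proofs-only file (theorems only, no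
definitions, no named facts).  For a primitive positive definite form `Q = (a, b, c)` of
discriminant `D = b² − 4ac < 0` let `τ_Q = (−b + √D)/2a` and `j(τ_Q) = j(ℤτ_Q + ℤ)`
(`Literature.NumberTheory.EllipticCurves.formJ`).  Following Cox, *Primes of the form x² + ny²*,
2nd ed., §10.C, proof of Thm. 10.23 ((10.24)–(10.26), PDF pp. 225–226 of the held copy) we prove:

* `exists_formJ_eq_ringEquiv_apply` — **(10.26)**: for every automorphism `σ` of `ℂ` there is a
  primitive positive definite form `Q'` with `disc Q' = disc Q` and `σ(j(τ_Q)) = j(τ_{Q'})`;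
  hence `ringEquiv_apply_formJ_mem_image`: `σ(j(τ_Q)) ∈ {j(τ_R) : R reduced of discriminant D}`.
* **Thm. 10.23** ("`j(𝔞)` is an algebraic number of degree at most `h(𝒪)`"):
  `isIntegral_formJ` (`j(τ_Q)` is algebraic over `ℚ`), `mem_image_of_aeval_minpoly_formJ` (every
  complex root of its minimal polynomial is a `j(τ_R)`, `R` reduced of discriminant `D`) and
  `natDegree_minpoly_formJ_le_classNumber` (`deg ≤ h(D)`), from the tree's `Aut(ℂ)` lemmas
  (`Literature/FieldTheory/AlgClosed/AutomorphismExtension.lean`).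

## The argument (Cox pp. 225–226, with the tree's polynomial CM certificates)

Let `Λ = ℤτ_Q + ℤ`; `w₀ = aτ_Q` is a complex multiplication of `Λ` (`aτ² = −bτ − c`), a root of
`X² + bX + ac`.  Cox transports the identity `℘(w₀z) = A(℘ z)/B(℘ z)` ((10.24)) along `σ`; here the
transportable form of "`Λ` has complex multiplication by `w₀`" is the pair `(P, R)` of
transformation polynomials with the identities `(H1)`, `(H2)`
(`PeriodPair.exists_transformation_of_mul_mem_lattice`, `CMTransformationPolynomials.lean`), whose
parameters are `w₀, g₂(Λ), g₃(Λ)` only.  Applying `σ` coefficientwise and choosing a lattice `L'`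
with `g₂(L') = σ(g₂)`, `g₃(L') = σ(g₃)` (Cox Cor. 11.7 = the tree's Uniformization Theorem
`PeriodPair.uniformization_holds`), the converse theorem
`PeriodPair.mul_mem_lattice_of_transformation` (`LatticeEndomorphism.lean`) gives
`σ(w₀)L' ⊆ L'` ((10.25)), so `L'` has complex multiplication and is homothetic to `ℤτ_{Q'} + ℤ` for
a primitive positive definite `Q' = (a', b', c')` (tree: `exists_isPrimitive_j_eq_of_hasCM`), and
`σ(j(Λ)) = j(L') = j(τ_{Q'})`.  That `disc Q' = disc Q` ("`𝒪 = 𝒪'` is the ring of complex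
multiplications of both", Cox p. 226) is obtained from Lemma 7.5 (`exists_int_of_mul_mem_lattice`:
the multipliers of `ℤτ_Q + ℤ` are the `m + k·aτ_Q`, `Q` primitive) applied on both sides —
`σ(w₀) = m + k·a'τ'` and, transporting `w₁ = a'τ'` back along `σ⁻¹` onto `Λ` itself,
`σ⁻¹(w₁) = m' + k'w₀` — whence `kk' = 1`, `σ(w₀) = m ± w₁`, and the two monic integer quadratics
satisfied by the non-real number `σ(w₀)` (of discriminants `disc Q` and `disc Q'`) coincide.

## References

* D. A. Cox, *Primes of the form x² + ny²*, 2nd ed., Wiley 2013: §7.A Lemma 7.5 (PDF p. 149),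
  §10.B Thm. 10.14, §10.C Thm. 10.23 and its proof, (10.24)–(10.26) (PDF pp. 225–226), Cor. 11.7.
  [Cox2013]
-/

noncomputable section

open Complex Polynomial
open scoped UpperHalfPlane

namespace Literature.NumberTheory.EllipticCurves

open Literature.NumberTheory.QuadraticFields.BinaryQuadraticForm
  Literature.NumberTheory.EllipticCurves.ModularForms

/-! ### Lemma 7.5: the multipliers of `ℤτ_Q + ℤ` for a primitive form `Q` -/

/-- **`aτ_Q` is a complex multiplication of `ℤτ_Q + ℤ`** (`aτ·τ = −bτ − c`; Cox, Lemma 7.5: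
`[1, aτ]` is contained in — indeed equals — the order of `[1, τ]`). [cite: Cox2013, §7.A Lemma 7.5] -/
theorem mul_mem_lattice_heegnerTau {Q : ℤ × ℤ × ℤ} (hQ1 : 0 < Q.1) (hdisc : discr Q < 0) :
    ∀ l ∈ (PeriodPair.ofUpperHalfPlane (heegnerTau Q)).lattice,
      (Q.1 : ℂ) * (heegnerTau Q : ℂ) * l ∈ (PeriodPair.ofUpperHalfPlane (heegnerTau Q)).lattice := by
  intro l hl
  obtain ⟨m, n, rfl⟩ := PeriodPair.mem_lattice.mp hl
  have hroot := heegnerTau_isRoot hQ1 hdisc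
  refine PeriodPair.mem_lattice.mpr ⟨Q.1 * n - Q.2.1 * m, -(Q.2.2 * m), ?_⟩
  simp only [PeriodPair.ofUpperHalfPlane_ω₁, PeriodPair.ofUpperHalfPlane_ω₂, mul_one]
  push_cast
  linear_combination (-(m : ℂ)) * hroot

/-- **Lemma 7.5 (the order of `[1, τ_Q]` is `[1, aτ_Q]`)**, inclusion used here: if `Q = (a, b, c)`
is primitive positive definite and `β(ℤτ_Q + ℤ) ⊆ ℤτ_Q + ℤ`, then `β = m + k·aτ_Q` with
`m, k ∈ ℤ` (`β = m₁τ + n₁` and `βτ ∈ ℤτ + ℤ` give `a ∣ bm₁, cm₁`, hence `a ∣ m₁` as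
`gcd(a, b, c) = 1`). [cite: Cox2013, §7.A Lemma 7.5] -/
theorem exists_int_of_mul_mem_lattice {Q : ℤ × ℤ × ℤ} (hQ1 : 0 < Q.1) (hprim : IsPrimitive Q)
    (hdisc : discr Q < 0) {β : ℂ}
    (hβ : ∀ l ∈ (PeriodPair.ofUpperHalfPlane (heegnerTau Q)).lattice,
      β * l ∈ (PeriodPair.ofUpperHalfPlane (heegnerTau Q)).lattice) :
    ∃ m k : ℤ, β = m + k * ((Q.1 : ℂ) * (heegnerTau Q : ℂ)) := by
  set τ := heegnerTau Q with hτ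
  have hroot := heegnerTau_isRoot hQ1 hdisc
  have h1 : (1 : ℂ) ∈ (PeriodPair.ofUpperHalfPlane τ).lattice := by
    simpa using (PeriodPair.ofUpperHalfPlane τ).ω₂_mem_lattice
  have hτmem : (τ : ℂ) ∈ (PeriodPair.ofUpperHalfPlane τ).lattice := by
    simpa using (PeriodPair.ofUpperHalfPlane τ).ω₁_mem_lattice
  obtain ⟨m₁, n₁, hβ1⟩ := PeriodPair.mem_lattice.mp (hβ 1 h1)
  obtain ⟨m₂, n₂, hβτ⟩ := PeriodPair.mem_lattice.mp (hβ _ hτmem)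
  simp only [PeriodPair.ofUpperHalfPlane_ω₁, PeriodPair.ofUpperHalfPlane_ω₂, mul_one] at hβ1 hβτ
  -- `a(βτ) = a(m₁τ² + n₁τ) = m₁(−bτ − c) + an₁τ = am₂τ + an₂`
  have key : ((Q.1 * n₁ - Q.2.1 * m₁ - Q.1 * m₂ : ℤ) : ℂ) * τ + ((-(Q.2.2 * m₁) - Q.1 * n₂ : ℤ) : ℂ) = 0 := by
    push_cast
    have : β * τ = (m₁ * τ + n₁) * τ := by rw [hβ1]
    rw [← hβτ] at this
    linear_combination (-(Q.1 : ℂ)) * this - (m₁ : ℂ) * hroot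
  obtain ⟨e1, e2⟩ := int_mul_coe_add_eq_zero key
  -- `a ∣ b m₁` and `a ∣ c m₁`, hence `a ∣ m₁` by a Bezout relation `ua + vb + wc = 1`
  have hb : Q.1 ∣ Q.2.1 * m₁ := ⟨n₁ - m₂, by linear_combination -e1⟩
  have hc : Q.1 ∣ Q.2.2 * m₁ := ⟨-n₂, by linear_combination -e2⟩
  have hprim' : Int.gcd (Int.gcd Q.1 Q.2.1) Q.2.2 = 1 := hprim
  have hbez : ∃ u v w : ℤ, u * Q.1 + v * Q.2.1 + w * Q.2.2 = 1 := by
    set g : ℤ := (Int.gcd Q.1 Q.2.1 : ℤ) with hg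
    have hg1 : g = Q.1 * Int.gcdA Q.1 Q.2.1 + Q.2.1 * Int.gcdB Q.1 Q.2.1 := Int.gcd_eq_gcd_ab Q.1 Q.2.1
    have hg2 : (Int.gcd g Q.2.2 : ℤ) = g * Int.gcdA g Q.2.2 + Q.2.2 * Int.gcdB g Q.2.2 :=
      Int.gcd_eq_gcd_ab g Q.2.2
    have h1 : (Int.gcd g Q.2.2 : ℤ) = 1 := by exact_mod_cast hprim'
    exact ⟨Int.gcdA Q.1 Q.2.1 * Int.gcdA g Q.2.2, Int.gcdB Q.1 Q.2.1 * Int.gcdA g Q.2.2,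
      Int.gcdB g Q.2.2, by linear_combination (-Int.gcdA g Q.2.2) * hg1 - hg2 + h1⟩
  obtain ⟨u, v, w, hbez'⟩ := hbez
  obtain ⟨t₁, ht₁⟩ := hb
  obtain ⟨t₂, ht₂⟩ := hc
  have hk : m₁ = Q.1 * (u * m₁ + v * t₁ + w * t₂) := by
    linear_combination (-m₁) * hbez' + v * ht₁ + w * ht₂
  refine ⟨n₁, u * m₁ + v * t₁ + w * t₂, ?_⟩
  have hkC : (m₁ : ℂ) = (Q.1 : ℂ) * ((u * m₁ + v * t₁ + w * t₂ : ℤ) : ℂ) := by exact_mod_cast hk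
  rw [← hβ1]
  linear_combination (τ : ℂ) * hkC

/-! ### Two elementary lemmas on quadratic numbers -/

/-- A root of `X² + BX + C` with `B, C` real and `B² − 4C < 0` is not real. [folklore] -/
lemma im_ne_zero_of_quadratic {w : ℂ} {B C : ℝ} (h : w ^ 2 + B * w + C = 0) (hd : B ^ 2 - 4 * C < 0) :
    w.im ≠ 0 := by
  intro hw
  have hre := congrArg Complex.re h
  simp only [add_re, mul_re, ofReal_re, ofReal_im, hw, mul_zero, sub_zero, zero_re, sq] at hre
  nlinarith [sq_nonneg (2 * w.re + B)]

/-- **The real monic quadratic of a non-real number is unique**: if `w ∉ ℝ` satisfies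
`w² + Bw + C = 0 = w² + B'w + C'` with real coefficients then `B = B'` and `C = C'`. [folklore] -/
lemma quadratic_coeff_unique {w : ℂ} (hw : w.im ≠ 0) {B C B' C' : ℝ}
    (h : w ^ 2 + B * w + C = 0) (h' : w ^ 2 + B' * w + C' = 0) : B = B' ∧ C = C' := by
  have hdiff : ((B - B' : ℝ) : ℂ) * w + ((C - C' : ℝ) : ℂ) = 0 := by
    push_cast
    linear_combination h - h'
  have him := congrArg Complex.im hdiff
  simp only [add_im, mul_im, ofReal_re, ofReal_im, zero_mul, add_zero, zero_im] at him
  have hB : B = B' := by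
    rcases mul_eq_zero.mp him with h0 | h0
    · linarith
    · exact absurd h0 hw
  refine ⟨hB, ?_⟩
  have hre := congrArg Complex.re hdiff
  simp only [add_re, mul_re, ofReal_re, ofReal_im, zero_mul, zero_re, hB, sub_self] at hre
  linarith

/-! ### Transport of complex multiplication along an automorphism of `ℂ` -/

/-- **(10.25): complex multiplication is transported by `Aut(ℂ)`.**  If `α ≠ 0`, `αΛ ⊆ Λ`, and
`L'` is a lattice with `g₂(L') = σ(g₂(Λ))`, `g₃(L') = σ(g₃(Λ))` for a field automorphism `σ` of `ℂ`,
then `σ(α)L' ⊆ L'`: map the transformation polynomials `(P, R)` of `α` and their identities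
`(H1)`, `(H2)` by `σ` (`PeriodPair.exists_transformation_of_mul_mem_lattice`,
`PeriodPair.mul_mem_lattice_of_transformation`).  Cox: "(10.25) tells us that `℘(z; L)` has complex
multiplication by `σ(α)`". [cite: Cox2013, §10.C proof of Thm. 10.23, (10.24)–(10.25)] -/
theorem mul_mem_lattice_of_ringEquiv (σ : ℂ ≃+* ℂ) {Λ L' : PeriodPair} {α : ℂ} (hα0 : α ≠ 0)
    (hα : ∀ l ∈ Λ.lattice, α * l ∈ Λ.lattice) (hg₂ : L'.g₂ = σ Λ.g₂) (hg₃ : L'.g₃ = σ Λ.g₃) :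
    ∀ l ∈ L'.lattice, σ α * l ∈ L'.lattice := by
  obtain ⟨P, R, hR0, h1, h2⟩ := Λ.exists_transformation_of_mul_mem_lattice hα0 hα
  have hσα : σ α ≠ 0 := fun h => hα0 (σ.injective (by rw [h, map_zero]))
  have hR0' : R.map (σ : ℂ →+* ℂ) ≠ 0 := (Polynomial.map_ne_zero_iff σ.injective).2 hR0
  have h1' := congrArg (Polynomial.map (σ : ℂ →+* ℂ)) h1
  have h2' := congrArg (Polynomial.map (σ : ℂ →+* ℂ)) h2
  have hσ4 : σ 4 = 4 := map_ofNat σ 4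
  have hσ2 : σ 2 = 2 := map_ofNat σ 2
  have hσ12 : σ 12 = 12 := map_ofNat σ 12
  simp only [Polynomial.map_mul, Polynomial.map_sub, Polynomial.map_add, Polynomial.map_pow,
    map_C, map_X, RingEquiv.coe_toRingHom, map_pow, hσ4, hσ2, hσ12, ← hg₂, ← hg₃] at h1' h2'
  intro l hl
  refine L'.mul_mem_lattice_of_transformation (P := P.map (σ : ℂ →+* ℂ)) hσα hR0' ?_ ?_ hl
  · simpa using h1'
  · simpa using h2'

/-- Multipliers are the same for homothetic lattices: if `Λ₁ = cΛ₂` then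
`βΛ₁ ⊆ Λ₁ ↔ βΛ₂ ⊆ Λ₂`. [folklore] -/
lemma mul_mem_lattice_iff_of_lattice_eq_mulLeft {L₁ L₂ : PeriodPair} {c : ℂ} {hc : c ≠ 0}
    (h : L₁.lattice = (L₂.mulLeft c hc).lattice) {β : ℂ} :
    (∀ x ∈ L₁.lattice, β * x ∈ L₁.lattice) ↔ ∀ x ∈ L₂.lattice, β * x ∈ L₂.lattice := by
  refine ⟨PeriodPair.mul_mem_lattice_of_lattice_eq_mulLeft h, fun hβ x hx => ?_⟩
  rw [h] at hx ⊢
  have hx' : c⁻¹ * x ∈ L₂.lattice := PeriodPair.mem_mulLeft_lattice.mp hx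
  have := hβ _ hx'
  rw [PeriodPair.mem_mulLeft_lattice, show c⁻¹ * (β * x) = β * (c⁻¹ * x) by ring]
  exact this

/-- `σ(j(Λ)) = j(L')` when `g₂(L') = σ(g₂(Λ))`, `g₃(L') = σ(g₃(Λ))`. [folklore] -/
lemma ringEquiv_apply_j (σ : ℂ ≃+* ℂ) {Λ L' : PeriodPair} (hg₂ : L'.g₂ = σ Λ.g₂) (hg₃ : L'.g₃ = σ Λ.g₃) :
    σ Λ.j = L'.j := by
  rw [PeriodPair.j_def, PeriodPair.j_def, hg₂, hg₃]
  simp only [map_div₀, map_mul, map_pow, map_sub, map_ofNat]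

/-! ### (10.26): `σ(j(τ_Q)) = j(τ_{Q'})` with `disc Q' = disc Q` -/

/-- **Cox (10.26), form version.**  For a primitive positive definite form `Q` and an automorphism
`σ` of `ℂ` there is a primitive positive definite form `Q'` of the same discriminant with
`σ(j(τ_Q)) = j(τ_{Q'})` ("`j(L) = σ(j(𝔞))`", `L` a proper `𝒪`-ideal up to homothety for the same
order `𝒪`).  See the module docstring for the proof.
[cite: Cox2013, §10.C proof of Thm. 10.23, (10.24)–(10.26)] -/
theorem exists_formJ_eq_ringEquiv_apply {Q : ℤ × ℤ × ℤ} (hQ1 : 0 < Q.1) (hprim : IsPrimitive Q)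
    (hdisc : discr Q < 0) (σ : ℂ ≃+* ℂ) :
    ∃ Q' : ℤ × ℤ × ℤ, 0 < Q'.1 ∧ IsPrimitive Q' ∧ discr Q' = discr Q ∧ σ (formJ Q) = formJ Q' := by
  set τ := heegnerTau Q with hτ
  set Λ := PeriodPair.ofUpperHalfPlane τ with hΛ
  have hroot := heegnerTau_isRoot hQ1 hdisc
  -- the complex multiplication `w₀ = aτ`, a root of `X² + bX + ac`
  set w₀ : ℂ := (Q.1 : ℂ) * (τ : ℂ) with hw₀
  have hw₀quad : w₀ ^ 2 + Q.2.1 * w₀ + Q.1 * Q.2.2 = 0 := by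
    rw [hw₀]; linear_combination (Q.1 : ℂ) * hroot
  have ha0 : (Q.1 : ℂ) ≠ 0 := by exact_mod_cast hQ1.ne'
  have hw₀0 : w₀ ≠ 0 := mul_ne_zero ha0 (UpperHalfPlane.ne_zero τ)
  have hw₀Λ : ∀ l ∈ Λ.lattice, w₀ * l ∈ Λ.lattice := mul_mem_lattice_heegnerTau hQ1 hdisc
  -- the conjugate lattice `L'`
  have hΔ : Λ.g₂ ^ 3 - 27 * Λ.g₃ ^ 2 ≠ 0 := Λ.discr_ne_zero
  have hΔ' : (σ Λ.g₂) ^ 3 - 27 * (σ Λ.g₃) ^ 2 ≠ 0 := by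
    intro h
    apply hΔ
    have h27 : σ (27 : ℂ) = 27 := map_ofNat σ 27
    have h' : σ (Λ.g₂ ^ 3 - 27 * Λ.g₃ ^ 2) = 0 := by
      rw [map_sub, map_pow, map_mul, map_pow, h27]; exact h
    exact σ.injective (h'.trans (map_zero σ).symm)
  obtain ⟨L', hg₂', hg₃'⟩ := PeriodPair.uniformization_holds _ _ hΔ'
  -- (10.25): `σ(w₀)` is a complex multiplication of `L'`
  have hCM' : ∀ l ∈ L'.lattice, σ w₀ * l ∈ L'.lattice := mul_mem_lattice_of_ringEquiv σ hw₀0 hw₀Λ hg₂' hg₃'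
  have hσquad : (σ w₀) ^ 2 + Q.2.1 * σ w₀ + Q.1 * Q.2.2 = 0 := by
    have := congrArg σ hw₀quad
    simpa using this
  have hdiscR : ((Q.2.1 : ℝ)) ^ 2 - 4 * ((Q.1 * Q.2.2 : ℤ) : ℝ) < 0 := by
    have hd : Q.2.1 ^ 2 - 4 * Q.1 * Q.2.2 < 0 := hdisc
    have : ((Q.2.1 ^ 2 - 4 * Q.1 * Q.2.2 : ℤ) : ℝ) < 0 := by exact_mod_cast hd
    push_cast at this ⊢; linarith
  have hσim : (σ w₀).im ≠ 0 :=
    im_ne_zero_of_quadratic (B := (Q.2.1 : ℝ)) (C := ((Q.1 * Q.2.2 : ℤ) : ℝ))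
      (by push_cast; exact_mod_cast hσquad) hdiscR
  have hHasCM : L'.HasCM := ⟨σ w₀, fun n hn => hσim (by rw [hn]; simp), hCM'⟩
  -- `L'` is homothetic to `Λ' = ℤτ' + ℤ`, `τ' = τ_{Q'}` with `Q'` primitive
  obtain ⟨Q', hQ'1, hQ'prim, hQ'disc, hjL'⟩ := exists_isPrimitive_j_eq_of_hasCM hHasCM
  set τ' := heegnerTau Q' with hτ'
  set Λ' := PeriodPair.ofUpperHalfPlane τ' with hΛ'
  obtain ⟨c₁, hc₁, hΛ'L'⟩ := PeriodPair.exists_lattice_eq_mulLeft_of_j_eq hjL'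
  have hroot' := heegnerTau_isRoot hQ'1 hQ'disc
  set w₁ : ℂ := (Q'.1 : ℂ) * (τ' : ℂ) with hw₁
  have ha0' : (Q'.1 : ℂ) ≠ 0 := by exact_mod_cast hQ'1.ne'
  have hw₁0 : w₁ ≠ 0 := mul_ne_zero ha0' (UpperHalfPlane.ne_zero τ')
  have hw₁Λ' : ∀ l ∈ Λ'.lattice, w₁ * l ∈ Λ'.lattice := mul_mem_lattice_heegnerTau hQ'1 hQ'disc
  -- Lemma 7.5 on the `L'` side: `σ w₀ = m + k w₁`
  have hσΛ' : ∀ l ∈ Λ'.lattice, σ w₀ * l ∈ Λ'.lattice :=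
    (mul_mem_lattice_iff_of_lattice_eq_mulLeft hΛ'L').2 hCM'
  obtain ⟨m, k, hmk⟩ := exists_int_of_mul_mem_lattice hQ'1 hQ'prim hQ'disc hσΛ'
  -- reverse transport: `σ⁻¹ w₁` is a multiplier of `Λ`, so `σ⁻¹ w₁ = m' + k' w₀`
  have hw₁L' : ∀ l ∈ L'.lattice, w₁ * l ∈ L'.lattice :=
    (mul_mem_lattice_iff_of_lattice_eq_mulLeft hΛ'L').1 hw₁Λ'
  have hg₂ : Λ.g₂ = σ.symm L'.g₂ := by rw [hg₂', RingEquiv.symm_apply_apply]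
  have hg₃ : Λ.g₃ = σ.symm L'.g₃ := by rw [hg₃', RingEquiv.symm_apply_apply]
  have hback : ∀ l ∈ Λ.lattice, σ.symm w₁ * l ∈ Λ.lattice := mul_mem_lattice_of_ringEquiv σ.symm hw₁0 hw₁L' hg₂ hg₃
  obtain ⟨m', k', hmk'⟩ := exists_int_of_mul_mem_lattice hQ1 hprim hdisc hback
  have hw₁eq : w₁ = m' + k' * σ w₀ := by
    have h := congrArg σ hmk'
    rw [RingEquiv.apply_symm_apply, map_add, map_mul, map_intCast, map_intCast] at h
    exact h
  -- `k k' = 1`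
  have hτ'im : (w₁).im ≠ 0 := by
    rw [hw₁, mul_im, intCast_re, intCast_im, zero_mul, add_zero, UpperHalfPlane.coe_im]
    exact mul_ne_zero (by exact_mod_cast hQ'1.ne') τ'.im_pos.ne'
  have hkk : k' * k = 1 := by
    have h : ((1 - k' * k : ℤ) : ℂ) * w₁ = ((m' + k' * m : ℤ) : ℂ) := by
      push_cast
      have : w₁ = m' + k' * (m + k * w₁) := by rw [← hmk]; exact hw₁eq
      linear_combination this
    have him := congrArg Complex.im h
    simp only [mul_im, intCast_re, intCast_im, zero_mul, add_zero] at him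
    rcases mul_eq_zero.mp him with h0 | h0
    · have : (1 - k' * k : ℤ) = 0 := by exact_mod_cast h0
      linarith
    · exact absurd h0 hτ'im
  -- the integer quadratic of `σ w₀` read off `w₁² + b'w₁ + a'c' = 0`
  have hw₁quad : w₁ ^ 2 + Q'.2.1 * w₁ + Q'.1 * Q'.2.2 = 0 := by
    rw [hw₁]; linear_combination (Q'.1 : ℂ) * hroot'
  have hdisc' : discr Q' = discr Q := by
    rcases Int.mul_eq_one_iff_eq_one_or_neg_one.mp hkk with ⟨-, rfl⟩ | ⟨-, rfl⟩
    · -- `σ w₀ = m + w₁`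
      have hq2 : (σ w₀) ^ 2 + ((Q'.2.1 - 2 * m : ℤ) : ℝ) * σ w₀ +
          ((m ^ 2 - Q'.2.1 * m + Q'.1 * Q'.2.2 : ℤ) : ℝ) = 0 := by
        push_cast
        have e : w₁ = σ w₀ - m := by rw [hmk]; push_cast; ring
        rw [e] at hw₁quad
        linear_combination hw₁quad
      obtain ⟨hB, hC⟩ := quadratic_coeff_unique hσim (B := (Q.2.1 : ℝ))
        (C := ((Q.1 * Q.2.2 : ℤ) : ℝ)) (by push_cast; exact_mod_cast hσquad) hq2
      have hB' : Q.2.1 = Q'.2.1 - 2 * m := by exact_mod_cast hB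
      have hC' : Q.1 * Q.2.2 = m ^ 2 - Q'.2.1 * m + Q'.1 * Q'.2.2 := by exact_mod_cast hC
      show Q'.2.1 ^ 2 - 4 * Q'.1 * Q'.2.2 = Q.2.1 ^ 2 - 4 * Q.1 * Q.2.2
      linear_combination (-(Q'.2.1 - 2 * m + Q.2.1)) * hB' + 4 * hC'
    · -- `σ w₀ = m - w₁`
      have hq2 : (σ w₀) ^ 2 + ((-Q'.2.1 - 2 * m : ℤ) : ℝ) * σ w₀ +
          ((m ^ 2 + Q'.2.1 * m + Q'.1 * Q'.2.2 : ℤ) : ℝ) = 0 := by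
        push_cast
        have e : w₁ = m - σ w₀ := by rw [hmk]; push_cast; ring
        rw [e] at hw₁quad
        linear_combination hw₁quad
      obtain ⟨hB, hC⟩ := quadratic_coeff_unique hσim (B := (Q.2.1 : ℝ))
        (C := ((Q.1 * Q.2.2 : ℤ) : ℝ)) (by push_cast; exact_mod_cast hσquad) hq2
      have hB' : Q.2.1 = -Q'.2.1 - 2 * m := by exact_mod_cast hB
      have hC' : Q.1 * Q.2.2 = m ^ 2 + Q'.2.1 * m + Q'.1 * Q'.2.2 := by exact_mod_cast hC
      show Q'.2.1 ^ 2 - 4 * Q'.1 * Q'.2.2 = Q.2.1 ^ 2 - 4 * Q.1 * Q.2.2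
      linear_combination (Q'.2.1 + 2 * m - Q.2.1) * hB' + 4 * hC'
  refine ⟨Q', hQ'1, hQ'prim, hdisc', ?_⟩
  rw [formJ_def, formJ_def, ← hjL']
  exact ringEquiv_apply_j σ hg₂' hg₃'

/-- **Singular moduli of discriminant `D` are permuted by `Aut(ℂ)`** (Cox (10.26) with Cor. 10.20):
`σ(j(τ_Q)) ∈ {j(τ_R) : R reduced of discriminant D}` for every primitive positive definite `Q` of
discriminant `D` and every automorphism `σ` of `ℂ`. [cite: Cox2013, §10.C proof of Thm. 10.23, (10.26)] -/
theorem ringEquiv_apply_formJ_mem_image {Q : ℤ × ℤ × ℤ} (hQ1 : 0 < Q.1) (hprim : IsPrimitive Q)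
    (hdisc : discr Q < 0) (σ : ℂ ≃+* ℂ) : σ (formJ Q) ∈ (reducedForms (discr Q)).image formJ := by
  obtain ⟨Q', hQ'1, hQ'prim, hQ'disc, hσ⟩ := exists_formJ_eq_ringEquiv_apply hQ1 hprim hdisc σ
  have hd' : discr Q' < 0 := by rw [hQ'disc]; exact hdisc
  rw [hσ, ← hQ'disc]
  exact formJ_mem_image_reducedForms hQ'1 hQ'prim hd'

/-! ### Theorem 10.23 -/

/-- **Cox, Thm. 10.23 (algebraicity): `j(τ_Q)` is an algebraic number** for every primitive positive
definite form `Q` — its `Aut(ℂ)`-orbit lies in the finite set of singular moduli of discriminant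
`disc Q`. [cite: Cox2013, §10.C Thm. 10.23] -/
theorem isIntegral_formJ {Q : ℤ × ℤ × ℤ} (hQ1 : 0 < Q.1) (hprim : IsPrimitive Q) (hdisc : discr Q < 0) :
    IsIntegral ℚ (formJ Q) :=
  Literature.FieldTheory.AlgClosed.Complex.isIntegral_of_forall_ringEquiv_mem
    ((reducedForms (discr Q)).image formJ).finite_toSet
    fun σ => Finset.mem_coe.2 (ringEquiv_apply_formJ_mem_image hQ1 hprim hdisc σ)

/-- **Cox, Thm. 10.23 (conjugates)**: every complex root of the minimal polynomial of `j(τ_Q)` over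
`ℚ` is `j(τ_R)` for a reduced form `R` of discriminant `disc Q` ("there are only `h(𝒪)`
possibilities for `σ(j(𝔞))`"). [cite: Cox2013, §10.C Thm. 10.23] -/
theorem mem_image_of_aeval_minpoly_formJ {Q : ℤ × ℤ × ℤ} (hQ1 : 0 < Q.1) (hprim : IsPrimitive Q)
    (hdisc : discr Q < 0) {y : ℂ} (hy : aeval y (minpoly ℚ (formJ Q)) = 0) :
    y ∈ (reducedForms (discr Q)).image formJ :=
  Finset.mem_coe.1 (Literature.FieldTheory.AlgClosed.Complex.mem_of_aeval_minpoly_eq_zero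
    ((reducedForms (discr Q)).image formJ).finite_toSet
    (fun σ => Finset.mem_coe.2 (ringEquiv_apply_formJ_mem_image hQ1 hprim hdisc σ)) hy)

/-- **Cox, Thm. 10.23 (degree bound)**: `j(τ_Q)` is an algebraic number of degree at most
`h(D)`, `D = disc Q`. [cite: Cox2013, §10.C Thm. 10.23] -/
theorem natDegree_minpoly_formJ_le_classNumber {Q : ℤ × ℤ × ℤ} (hQ1 : 0 < Q.1)
    (hprim : IsPrimitive Q) (hdisc : discr Q < 0) :
    (minpoly ℚ (formJ Q)).natDegree ≤ classNumber (discr Q) :=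
  (Literature.FieldTheory.AlgClosed.Complex.natDegree_minpoly_le_card
    fun σ => ringEquiv_apply_formJ_mem_image hQ1 hprim hdisc σ).trans Finset.card_image_le

end Literature.NumberTheory.EllipticCurves

end
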